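import Summits.Ventures.AbcSig.Rows.Bridge
import Summits.Ventures.AbcSig.Rows.C2aL349A0
import Summits.Ventures.AbcSig.Rows.C2aL349A0AB

/-!
# Venture AbcSig — CELL `C2aL349A0`: the census statement `Rows.C2aCellRed 349 (fun a => a = 0) {11}` from the two row theorems

HONEST FRAMING. COMPUTATION cell `pub-abcsig`; CONDITIONAL theorem; no claim on ABC or any summit. Hypotheses exactly as in
`Rows/C2aL349A0.lean` and `Rows/C2aL349A0AB.lean`: `BS04Package` (CITED), `DataComplete` / `RefinesCPSymAll` (COMPUTED, certified level files;
norm-form certificates), and the rows' per-orbit CITED exclusions universally quantified in the exponent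
(shared by both distributions (a = 0: the second is the first with x, y swapped)). Conclusion = p1's census predicate (`Rows/Statements.lean`) with the residual of the row of
record `census/rows/C2a/C2a-l349-a0.md` (sha16 `5f177bc5d446ec07`): all four coprime distributions `A·B = 2^0·349^m`, reduced exponents.
GENERATED by p-lean g4 `gen4/c2arow2.py` (pattern of `Rows/C2aL277A0XCell.lean`).
-/

namespace Summit.Ventures.AbcSig

/-- Cell `C2aL349A0`: `Rows.C2aCellRed 349 (fun a => a = 0) {11}` under the rows' hypotheses. -/
theorem xcell_C2aL349A0 (M : NewformModel) (hP : M.BS04Package)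
    (hD11168 : M.DataComplete 11168 level11168Orbits) (hCP11168 : M.RefinesCPSymAll 11168 level11168CP)
    (hD698 : M.DataComplete 698 level698Orbits)
    (hX_orbit_11168_8 : ∀ n m : ℕ, n ∈ ([17] : List ℕ) → M.Excludes 11168 orbit_11168_8 (famB (2 ^ 0 * 349 ^ m) n (fun _ _ => True))) :
    Rows.C2aCellRed 349 (fun a => a = 0) {11} :=
  C2aCellRed_of_rows 349 (by norm_num) (by norm_num) _ _
    (fun n hn h11 hnℓ hR a m (ha : a = 0) han hm hmn x y z h1 h2 => by
      subst ha
      exact xrow_C2aL349A0 M hP  hD11168 hCP11168 hD698 n hn h11 hnℓ (by simpa using hR) m hm hmn (hX_orbit_11168_8 n m) x y z h1 h2)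
    (fun n hn h11 hnℓ hR a m (ha : a = 0) han hm hmn x y z h1 h2 => by
      subst ha
      exact xrow_C2aL349A0AB M hP  hD11168 hCP11168 hD698 n hn h11 hnℓ (by simpa using hR) m hm hmn (hX_orbit_11168_8 n m) x y z h1 h2)

end Summit.Ventures.AbcSig
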